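import Literature.AnabelianGeometry.EtaleTheta.SettingModelChiZNStandardSplitting
import Literature.AnabelianGeometry.EtaleTheta.SettingModelKrullCuspThm16Origin
import HarnessLib

/-!
# The cusped KRULL model `modelκ′`: `N·(Δ^tp_Y)^Θ` in level coordinates and the `Z_N`-clause for the standard
# splitting (κ′-twin of `SettingModelChiZNStandardSplitting`; proof-only)

Mochizuki, *The étale theta function and its Frobenioid-theoretic manifestations*, Publ. RIMS **45** (2009) [EtTh],
§1 pp. 13–14 («any two splittings of `(Π^tp_{Y_N})^Θ/N·(Δ^tp_Y)^Θ ↠ G_{K_N}` … determine the same splitting over `G_{J_N}`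
… whose kernel we denote by `Π^tp_{Z_N}`») [cite: MochizukiEtTh2009, §1 p.14].
abc-iut cell, layer L2, seat abc-iut-L2-t1 (§1 ROOT owner, gen 7; row 4 «`GtpZNFromSplitting` at `modelκ′`», file A).
PROOF-ONLY κ′-twin of abc-iut-L2-d1's `SettingModelChiZNStandardSplitting` (χ-model) at abc-iut-L2-t10's cusped Krull model
`ThetaSetting.modelκ' p` (`Π^tp_X = Γ ⋊_{θ∘1} G_{ℚ_p}` with the TRIVIAL Galois action on `Γ`, `Y_N = dY N ⋊ G_{K_N}`,
`Z_N = dZ N ⋊ G_{J_N}`, theta quotients from the generic `CurveTheta` record `curveκ′`): the level-coordinate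
computation is verbatim the χ-model one (it never uses the twist) —
* `toThetaκ'_inl_mem_thetaPowersY_iff` — for `γ ∈ Ker pr₂`: `θ(inl γ) ∈ N·(Δ^tp_Y)^Θ ↔ ĥ_N(γ) = 1`;
* `isThetaSplittingAt_inr_modelκ'` — the standard splitting `σ ↦ θ(inr σ)` over `G_{K_N}` is a lifted splitting;
* **`gtpZN_iff_of_inr_splitting_modelκ'`** — the clause of abc-iut-L2-t1's `GtpZNFromSplitting` HOLDS for it;
  `exists_thetaSplitting_gtpZN_iff_modelκ'` (∃-form).
The ∀-splittings clause is file B (`SettingModelKrullZNAllSplittings`, strong completeness of `G_{ℚ_p}`).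
WHY: `modelκ′` is the tree's inhabitant of `IsThm16Origin` (abc-iut-w5-d165 / abc-iut-L2-t10, p441852/p442699); with files
A/B the `IsThm16Origin`-side of the K3 end-knit v5's setting-level inputs (`SettingModelThm16iiiOriginInputsCensus`)
carries `GtpZNFromSplitting` ∀N as well. SEMI-SYNTHETIC MODEL, consistency evidence only; nothing of [EtTh] asserted;
no side taken on [IUTchIII] Cor. 3.12; typed ≠ proved.
-/

noncomputable section

namespace Literature.AnabelianGeometry.EtaleTheta.SettingModel

open Literature.AnabelianGeometry.SemiGraphs _root_.Function

variable (p : ℕ) [Fact p.Prime] (N : ℕ+)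

/-! ### Bookkeeping at `curveκ′` -/

/-- `inl δ ∈ Δ^tp_Y` of `modelκ′` for `δ ∈ Ker pr₂`. [cite: MochizukiEtTh2009, §1 p.12] -/
theorem inl_mem_dtpY_modelκ'_of_mem_ker {δ : Gfp} (hδ : δ ∈ gfpSnd.ker) :
    (SemidirectProduct.inl δ : PiTpκ p) ∈ (ThetaSetting.modelκ' p).DtpY :=
  (mem_dtpY_modelκ'_iff p _).mpr ⟨by rwa [SemidirectProduct.left_inl], SemidirectProduct.right_inl _⟩

/-- Two elements of `Π^tp_X = Γ ⋊_{θ∘1} G_{ℚ_p}` with trivial `G`-component and `F̂₂`-components congruent modulo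
`[[F̂₂,F̂₂],F̂₂]⁻` have the same image in `(Π^tp_X)^Θ` (κ′-twin of abc-iut-L2-d1's `toTheta_eq_of_right_eq_one`).
[cite: MochizukiEtTh2009, §1 p.12] -/
theorem toThetaκ'_eq_of_right_eq_one (x y : PiTpκ p) (hx : x.right = 1) (hy : y.right = 1)
    (h : gfpFst x.left * (gfpFst y.left)⁻¹ ∈
      (⁅⁅(⊤ : Subgroup F₂hatT), (⊤ : Subgroup F₂hatT)⁆, (⊤ : Subgroup F₂hatT)⁆).topologicalClosure) :
    CurveTheta.toTheta (curveκ' p) x = CurveTheta.toTheta (curveκ' p) y := by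
  rw [CurveTheta.toTheta, QuotientGroup.mk'_apply, QuotientGroup.mk'_apply, QuotientGroup.eq_iff_div_mem]
  change x / y ∈ CurveTheta.thetaKer (curveκ p)
  rw [mem_thetaKer_curveκ_iff]
  have hr : (x / y).right = 1 := by
    simp only [div_eq_mul_inv, SemidirectProduct.mul_right, SemidirectProduct.inv_right, hx, hy, inv_one, mul_one]
  refine ⟨fun M => ?_, hr⟩
  have hl : gfpFst (x / y).left = gfpFst x.left * (gfpFst y.left)⁻¹ := by
    simp only [div_eq_mul_inv, SemidirectProduct.mul_left, SemidirectProduct.inv_left, hx, hy, inv_one, map_one,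
      MulAut.one_apply, map_mul, map_inv]
  rw [hl]
  exact (mem_closure_commutator₃_iff_forall_hHat _).mp h M

/-- Equal images in `(Π^tp_X)^Θ` of `inl γ`, `inl γ′` force equal level shadows (κ′). [cite: MochizukiEtTh2009, §1 p.12] -/
theorem levelHom_eq_of_toThetaκ'_inl_eq {γ γ' : Gfp}
    (h : CurveTheta.toTheta (curveκ' p) (SemidirectProduct.inl γ) =
      CurveTheta.toTheta (curveκ' p) (SemidirectProduct.inl γ')) (M : ℕ+) :
    levelHom M γ = levelHom M γ' := by
  rw [CurveTheta.toTheta, QuotientGroup.mk'_apply, QuotientGroup.mk'_apply, QuotientGroup.eq_iff_div_mem,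
    ← map_div] at h
  change (SemidirectProduct.inl (γ / γ') : PiTpκ p) ∈ CurveTheta.thetaKer (curveκ p) at h
  rw [mem_thetaKer_curveκ_iff] at h
  have h1 := h.1 M
  rw [SemidirectProduct.left_inl] at h1
  change levelHom M (γ / γ') = 1 at h1
  rw [map_div] at h1
  exact div_eq_one.mp h1

/-! ### `N·(Δ^tp_Y)^Θ` at `modelκ′` -/

/-- `N·(Δ^tp_Y)^Θ ≤ θ(inl(Δ^tp_{Z_N}))` (κ′). [cite: MochizukiEtTh2009, §1 p.14] -/
theorem thetaPowersY_modelκ'_le :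
    (ThetaSetting.modelκ' p).thetaPowersY N ≤
      (dZ N).map ((CurveTheta.toTheta (curveκ' p)).comp (SemidirectProduct.inl : Gfp →* PiTpκ p)) := by
  rw [ThetaSetting.thetaPowersY, Subgroup.closure_le]
  rintro _ ⟨y, hy, rfl⟩
  obtain ⟨g, hg, rfl⟩ := hy
  obtain ⟨hs, hr⟩ := (mem_dtpY_modelκ'_iff p g).mp hg
  have hg' : g = SemidirectProduct.inl g.left := eq_inl_of_right_eq_one_κ hr
  refine ⟨g.left ^ (N : ℕ), pow_mem_dZ_of_mem_ker N hs, ?_⟩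
  change CurveTheta.toTheta (curveκ' p) (SemidirectProduct.inl (g.left ^ (N : ℕ))) =
    CurveTheta.toTheta (curveκ' p) g ^ (N : ℕ)
  rw [map_pow, map_pow, ← hg']

/-- `θ(inl(Δ^tp_{Z_N})) ≤ N·(Δ^tp_Y)^Θ` (κ′): `θ(inl γ) = θ(inl(b^s c^u))^N` with `s^N = ŷ(γ)`, `u^N = ẑ(γ)`.
[cite: MochizukiEtTh2009, §1 p.14] -/
theorem toThetaκ'_inl_mem_thetaPowersY_of_mem_dZ {γ : Gfp} (hγ : γ ∈ dZ N) :
    CurveTheta.toTheta (curveκ' p) (SemidirectProduct.inl γ) ∈ (ThetaSetting.modelκ' p).thetaPowersY N := by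
  obtain ⟨hs, hl⟩ := Subgroup.mem_inf.mp hγ
  rw [MonoidHom.mem_ker] at hl
  obtain ⟨t, ht⟩ := exists_zHat_forall_hHat_z_eq (gfpFst γ)
  have hy : ZHatLevel.level N (eHatB (gfpFst γ)) = 1 := by
    rw [← modN_eq_level, ← hHat_y_eq_zero_iff]
    change (levelHom N γ).y = 0
    rw [hl]
    rfl
  have htN : ZHatLevel.level N t = 1 := by
    have h := ht N
    change _ = (levelHom N γ).z at h
    rw [hl] at h
    rw [← modN_eq_level, ← ofAdd_toAdd (modN N t), h]
    rfl
  obtain ⟨s, hs'⟩ := (ZHatLevel.level_eq_one_iff_exists_pow N _).mp hy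
  obtain ⟨u, hu⟩ := (ZHatLevel.level_eq_one_iff_exists_pow N _).mp htN
  have hδ : bPowGfp s * cGfpχ u ∈ gfpSnd.ker := by
    rw [MonoidHom.mem_ker, map_mul, gfpSnd_bPowGfp, one_mul]
    rfl
  have hδY : (SemidirectProduct.inl (bPowGfp s * cGfpχ u) : PiTpκ p) ∈ (ThetaSetting.modelκ' p).DtpY :=
    inl_mem_dtpY_modelκ'_of_mem_ker p hδ
  have key : CurveTheta.toTheta (curveκ' p) (SemidirectProduct.inl γ) =
      CurveTheta.toTheta (curveκ' p) (SemidirectProduct.inl ((bPowGfp s * cGfpχ u) ^ (N : ℕ))) := by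
    refine toThetaκ'_eq_of_right_eq_one p _ _ (SemidirectProduct.right_inl _) (SemidirectProduct.right_inl _) ?_
    rw [mem_closure_commutator₃_iff_forall_hHat]
    intro M
    rw [SemidirectProduct.left_inl, SemidirectProduct.left_inl, map_mul, map_inv]
    change levelHom M γ * (levelHom M ((bPowGfp s * cGfpχ u) ^ (N : ℕ)))⁻¹ = 1
    rw [mul_inv_eq_one, map_pow, map_mul, levelHom_bPowGfp]
    change hHat M (gfpFst γ) = (_ * hHat M (gfpFst (cGfpχ u))) ^ (N : ℕ)
    have hx0 : ((⟨0, Multiplicative.toAdd (ZHatLevel.level M s), 0⟩ : Heis (ZMod M)) *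
        hHat M (gfpFst (cGfpχ u))).x = 0 := by
      rw [gfpFst_cGfpχ, hHat_powHat_commutator, Heis.mul_x, add_zero]
    rw [Heis.pow_eq_of_x_eq_zero _ hx0, gfpFst_cGfpχ, hHat_powHat_commutator]
    have hyM : (hHat M (gfpFst γ)).y = (N : ZMod M) * Multiplicative.toAdd (ZHatLevel.level M s) := by
      have h := hHat_y_eq_modN_eHatB M (gfpFst γ)
      rw [← hs', modN_eq_level, map_pow] at h
      rw [← toAdd_ofAdd (hHat M (gfpFst γ)).y, h, toAdd_pow, nsmul_eq_mul]
    have hzM : (hHat M (gfpFst γ)).z = (N : ZMod M) * Multiplicative.toAdd (ZHatLevel.level M u) := by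
      rw [← ht M, ← hu, modN_eq_level, map_pow, toAdd_pow, nsmul_eq_mul]
    ext
    · change (levelHom M γ).x = _
      rw [levelHom_x_eq_zero hs]
    · rw [hyM, Heis.mul_y, add_zero]
    · rw [hzM, Heis.mul_z, zero_mul, add_zero, zero_add]
  rw [key, map_pow, map_pow]
  exact Subgroup.subset_closure ⟨_, ⟨_, hδY, rfl⟩, rfl⟩

/-- **`N·(Δ^tp_Y)^Θ` in level coordinates (κ′)**: for `γ ∈ Ker pr₂`, `θ(inl γ) ∈ N·(Δ^tp_Y)^Θ ↔ ĥ_N(γ) = 1`.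
[cite: MochizukiEtTh2009, §1 p.14] -/
theorem toThetaκ'_inl_mem_thetaPowersY_iff {γ : Gfp} (hγ : γ ∈ gfpSnd.ker) :
    CurveTheta.toTheta (curveκ' p) (SemidirectProduct.inl γ) ∈ (ThetaSetting.modelκ' p).thetaPowersY N ↔
      levelHom N γ = 1 := by
  constructor
  · intro h
    obtain ⟨γ', hγ', hEq⟩ := thetaPowersY_modelκ'_le p N h
    rw [← levelHom_eq_of_toThetaκ'_inl_eq p hEq N]
    exact (Subgroup.mem_inf.mp hγ').2
  · intro h
    exact toThetaκ'_inl_mem_thetaPowersY_of_mem_dZ p N (Subgroup.mem_inf.mpr ⟨hγ, h⟩)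

/-! ### The standard splitting and the `Z_N`-clause for it (κ′) -/

/-- `inr σ ∈ Π^tp_{Y_N}` of `modelκ′` for `σ ∈ G_{K_N}`. [cite: MochizukiEtTh2009, §1 p.13] -/
theorem inr_mem_YNκ' {σ : GQp p} (hσ : σ ∈ (fieldKN ⊥ (qModel p) N).fixingSubgroup) :
    (SemidirectProduct.inr σ : PiTpκ p) ∈ YNκ p N :=
  (GfpTwistData.mem_YN (krullTwistData p)).mpr ⟨by rw [SemidirectProduct.left_inr]; exact Subgroup.one_mem _, hσ⟩

/-- The standard lifted splitting `σ ↦ θ(inr σ)` over `G_{K_N}` of `modelκ′` is a lifted splitting.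
[cite: MochizukiEtTh2009, §1 p.14] -/
theorem isThetaSplittingAt_inr_modelκ' :
    (ThetaSetting.modelκ' p).IsThetaSplittingAt N
      (fun σ => (ThetaSetting.modelκ' p).toTheta (SemidirectProduct.inr (σ : GQp p))) where
  exists_lift σ := ⟨SemidirectProduct.inr (σ : GQp p), inr_mem_YNκ' p N σ.2, rfl, rfl⟩
  map_mul_mem σ τ := by
    show (ThetaSetting.modelκ' p).toTheta
        (SemidirectProduct.inr ((σ * τ : ↥((ThetaSetting.modelκ' p).GKN N)) : GQp p)) *
        ((ThetaSetting.modelκ' p).toTheta (SemidirectProduct.inr (σ : GQp p)) *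
          (ThetaSetting.modelκ' p).toTheta (SemidirectProduct.inr (τ : GQp p)))⁻¹ ∈ _
    rw [Subgroup.coe_mul, map_mul, map_mul, mul_inv_cancel]
    exact Subgroup.one_mem _

/-- `g · (inr g.right)⁻¹ = inl g.left` in `Γ ⋊_{θ∘1} G`. [cite: MochizukiEtTh2009, §1 p.12] -/
theorem mul_inv_inr_right_eq_inl_κ' (g : PiTpκ p) :
    g * (SemidirectProduct.inr g.right)⁻¹ = SemidirectProduct.inl g.left := by
  rw [← map_inv]
  refine SemidirectProduct.ext ?_ ?_
  · rw [SemidirectProduct.mul_left, SemidirectProduct.left_inr, map_one, mul_one, SemidirectProduct.left_inl]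
  · rw [SemidirectProduct.mul_right, SemidirectProduct.right_inr, mul_inv_cancel, SemidirectProduct.right_inl]

/-- **The clause of `GtpZNFromSplitting` HOLDS at `modelκ′` for the standard splitting.**
[cite: MochizukiEtTh2009, §1 p.14] -/
theorem gtpZN_iff_of_inr_splitting_modelκ' (g : PiTpκ p) :
    g ∈ (ThetaSetting.modelκ' p).GtpZN N ↔
      g ∈ (ThetaSetting.modelκ' p).GtpYN N ∧ ∃ h : (ThetaSetting.modelκ' p).aug g ∈ (ThetaSetting.modelκ' p).GJN N,
        (ThetaSetting.modelκ' p).toTheta g *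
          ((fun σ : ↥((ThetaSetting.modelκ' p).GKN N) =>
              (ThetaSetting.modelκ' p).toTheta (SemidirectProduct.inr (σ : GQp p)))
            ⟨(ThetaSetting.modelκ' p).aug g, (ThetaSetting.modelκ' p).GJN_le_GKN N h⟩)⁻¹ ∈
          (ThetaSetting.modelκ' p).thetaPowersY N := by
  constructor
  · intro hZ
    obtain ⟨hl, hr⟩ := (GfpTwistData.mem_ZN (krullTwistData p)).mp hZ
    refine ⟨(GfpTwistData.mem_YN (krullTwistData p)).mpr
        ⟨dZ_le_dY N hl, (ThetaSetting.modelκ' p).GJN_le_GKN N hr⟩, hr, ?_⟩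
    show CurveTheta.toTheta (curveκ' p) g * (CurveTheta.toTheta (curveκ' p) (SemidirectProduct.inr g.right))⁻¹ ∈ _
    rw [← map_inv, ← map_mul, mul_inv_inr_right_eq_inl_κ']
    exact toThetaκ'_inl_mem_thetaPowersY_of_mem_dZ p N hl
  · rintro ⟨hY, hr, hmem⟩
    obtain ⟨hl, -⟩ := (GfpTwistData.mem_YN (krullTwistData p)).mp hY
    have hs : g.left ∈ gfpSnd.ker := (Subgroup.mem_inf.mp hl).1
    change CurveTheta.toTheta (curveκ' p) g *
        (CurveTheta.toTheta (curveκ' p) (SemidirectProduct.inr g.right))⁻¹ ∈ _ at hmem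
    rw [← map_inv, ← map_mul, mul_inv_inr_right_eq_inl_κ'] at hmem
    exact (GfpTwistData.mem_ZN (krullTwistData p)).mpr
      ⟨Subgroup.mem_inf.mpr ⟨hs, (toThetaκ'_inl_mem_thetaPowersY_iff p N hs).mp hmem⟩, hr⟩

/-- **∃-form (κ′)**: there IS a lifted splitting over `G_{K_N}` for which the printed characterisation of `Π^tp_{Z_N}`
holds at `modelκ′`. [cite: MochizukiEtTh2009, §1 p.14] -/
theorem exists_thetaSplitting_gtpZN_iff_modelκ' :
    ∃ s : ↥((ThetaSetting.modelκ' p).GKN N) → (ThetaSetting.modelκ' p).GtpTheta,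
      (ThetaSetting.modelκ' p).IsThetaSplittingAt N s ∧
        ∀ g : PiTpκ p, g ∈ (ThetaSetting.modelκ' p).GtpZN N ↔
          g ∈ (ThetaSetting.modelκ' p).GtpYN N ∧ ∃ h : (ThetaSetting.modelκ' p).aug g ∈ (ThetaSetting.modelκ' p).GJN N,
            (ThetaSetting.modelκ' p).toTheta g *
                (s ⟨(ThetaSetting.modelκ' p).aug g, (ThetaSetting.modelκ' p).GJN_le_GKN N h⟩)⁻¹ ∈
              (ThetaSetting.modelκ' p).thetaPowersY N :=
  ⟨_, isThetaSplittingAt_inr_modelκ' p N, gtpZN_iff_of_inr_splitting_modelκ' p N⟩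

end Literature.AnabelianGeometry.EtaleTheta.SettingModel

end
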